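import Summits.BirchSwinnertonDyer.Rank1Residual.X12.InertBadLocalTypes
import HarnessLib

/-!
# The local types of the X12 corner at an INERT bad `p = 3` (`K ≠ ℚ(√−3)`): `III, I₀*, III*` — `e ∣ 3 + 1`
# (CLASS-CLOSURE §3.14 / O10 at `p = 3` = RESIDUAL-MAP row K12i@3)

HONEST FRAMING (cell `b2b-bsdres`, run/shared/lean/b2b/bsd-rank1-residual/, verbatim in every
file): the goal of the cell is to DELETE the COMBINATION-SHAPED residual classes of the
Birch–Swinnerton-Dyer formula for ALL analytic-rank `≤ 1` elliptic curves over `ℚ` — "full BSD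
formula for every rank `≤ 1` curve in class `C`" assembled STRICTLY from published theorems — so
that the rank-`≤ 1` remainder becomes exactly the CONSTRUCTION-SHAPED classes, which are TYPED
(missing-input `Prop`s), NOT attempted. This is not "finishing BSD". Unit `b2b-bsdres-x1b` (X12
prover owner), generation 24; research route, no claim beyond the stated class; X12 REMAINS
CONSTRUCTION-SHAPED; nothing is booked here — booking is the lane's and the referee's.

Theorems only; no definition, no new named fact. Gen 23's `hasGoodReductionAt_or_kodairaSymbolAt_of_hasCM`
classifies the Kodaira type of a CM curve at a place of residue characteristic `ℓ ≥ 5` not ramified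
in the CM field; this file removes the restriction `ℓ ≥ 5` at `ℓ = 3`: if `3` is NOT ramified in the
CM field `K` (equivalently `K ≠ ℚ(√−3)`, i.e. `j ∉ {0, 54000, −12288000}`), a CM curve over `ℚ` has at
the place over `3` good reduction, or `j = 1728` and type `III, I₀*, III*` (gen 22's quartic engine,
valid at every `v ∤ 2`), or `j ∉ {0, 1728}` and type `I₀*` (gen 23's twist lemma at `v ∤ 2`; the nine
base models `256a1, 49a1, 121b1, 32a3, 361a1, 49a2, 1849a1, 4489a1, 26569a1` are good at `3`). Hence on
the X12 sub-family "CM, `r_an = 1`, `3 ∣ N`, `3` inert in `K`" (RESIDUAL-MAP K12i@3, 154 class-pairs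
`N < 5·10⁵`, HOME `b2b-bsdres-x1b/gen12/census3/`) the semistability defect is `e ∈ {2, 4}` and
`e ∣ 3 + 1` — the `p = 3` line of the local-type law of `InertBadLocalTypes.lean`
(`semistabilityDefect_dvd_succ_of_classX12_of_cmInert`, `p ≥ 5`). Also recorded: the bridge
`good_iff_hasGoodReductionAt` between the prime predicate `Good W p` and the place predicate.
Census companion (evidence, not a theorem): HOME `b2b-bsdres-x1b/gen24/locdiv/LOCDIV-3.tsv` (types
III 48 / I₀* 57 / III* 49 classes). Not claimed: `j ∈ {0, 54000, −12288000}` at `3` (wild; CM field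
`ℚ(√−3)`, `3` ramified — the O11-type corner), the place over `2`, anything about BSD.

References: [SilvermanATAEC1994] IV.9.4, Table 4.1, App. A §3; [SilvermanAEC2009] X.5 Prop. 5.4,
VII.1 Rem. 1.1, VII.5 Prop. 5.1; [Cremona1997] Table 1; HOME `X12-ROUTE.md` §28.
-/

noncomputable section

open scoped Classical NumberField

open WeierstrassCurve NumberField IsDedekindDomain IsDedekindDomain.HeightOneSpectrum Field
  Rat.HeightOneSpectrum Literature.NumberTheory.EllipticCurves
  Literature.NumberTheory.GaloisRepresentations
  Literature.NumberTheory.EllipticCurves.ModularForms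
  Literature.NumberTheory.EllipticCurves.Rank1Residual
  Literature.NumberTheory.EllipticCurves.Rank1Residual.Typed
  Literature.NumberTheory.Automorphic
  Literature.NumberTheory.DiophantineGeometry
  Literature.NumberTheory.DiophantineGeometry.TateAlgorithm
  Summit.BirchSwinnertonDyer.Rank1Residual.X11b

namespace Summit.BirchSwinnertonDyer.Rank1Residual.X12

/-- **`Good W p ⟺ W.HasGoodReductionAt v`** for the place `v` over `p` (`natGenerator v = p`): the
prime predicate of the cell's HYPOTHESES table is the place predicate of the Tate-algorithm library
(tree `hasGoodReductionAtPrime_iff_hasGoodReductionAt_ringOfIntegers`, `primesEquiv v = natGenerator v`).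
[cite: SilvermanAEC2009, VII.5 Prop. 5.1(a) and VII.1 Prop. 1.3(b)] -/
theorem good_iff_hasGoodReductionAt (W : WeierstrassCurve ℚ) (p : ℕ) [Fact p.Prime]
    (v : HeightOneSpectrum (𝓞 ℚ)) (hv : natGenerator v = p) : Good W p ↔ W.HasGoodReductionAt v := by
  rw [← hasGoodReductionAtPrime_iff_hasGoodReductionAt_ringOfIntegers v W]
  subst hv
  exact Iff.rfl

/-- **The Kodaira type of a CM curve over `ℚ` at the place over `3`, `3` NOT ramified in the CM
field** (`K ≠ ℚ(√−3)`): good reduction, or `j = 1728` and type `III, I₀*, III*`, or `j ∉ {0, 1728}`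
and type `I₀*` (a quadratic twist of one of the base models `256a1, 49a1, 121b1, 32a3, 361a1, 49a2,
1849a1, 4489a1, 26569a1`, all of good reduction at `3`). The three `ℚ(√−3)`-values
`j ∈ {0, 54000, −12288000}` are excluded by the hypothesis. [cite: SilvermanATAEC1994, IV.9.4, Table 4.1 and App. A §3]
[cite: SilvermanAEC2009, X.5 Prop. 5.4] [cite: Cremona1997, Table 1 (curves 32a3, 49a1, 49a2, 121b1, 256a1, 361a1, 1849a1, 4489a1, 26569a1)] -/
theorem hasGoodReductionAt_or_kodairaSymbolAt_of_hasCM_three (W : WeierstrassCurve ℚ) [W.IsElliptic]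
    (hCM : W.HasCM) (v : HeightOneSpectrum (𝓞 ℚ)) (hv : natGenerator v = 3)
    (hnr : ¬ CMRamified W 3) :
    W.HasGoodReductionAt v ∨
      (W.j = 1728 ∧ (W.kodairaSymbolAt v = .III ∨ W.kodairaSymbolAt v = .Istar 0 ∨
        W.kodairaSymbolAt v = .IIIstar)) ∨
      (W.j ≠ 0 ∧ W.j ≠ 1728 ∧ W.kodairaSymbolAt v = .Istar 0) := by
  have hv2 : natGenerator v ≠ 2 := by rw [hv]; decide
  have hj : W.j ∈ cmJInvariants := (hasCM_iff_j_mem_holds W).mp hCM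
  -- the three `ℚ(√−3)` values are ramified at `3`
  have hram : ∀ {j₀ : ℚ}, W.j = j₀ → cmFieldDiscrOfJ j₀ = -3 → False :=
    fun {j₀} h hd ↦ hnr (by unfold CMRamified; rw [h, hd]; norm_num)
  -- the generic twist case at `v` over `3`
  have twist : ∀ (a1 a2 a3 a4 a6 : ℤ)
      [hE : (⟨(a1 : ℚ), (a2 : ℚ), (a3 : ℚ), (a4 : ℚ), (a6 : ℚ)⟩ : WeierstrassCurve ℚ).IsElliptic] (Dz : ℤ),
      (⟨(a1 : ℚ), (a2 : ℚ), (a3 : ℚ), (a4 : ℚ), (a6 : ℚ)⟩ : WeierstrassCurve ℚ).Δ = Dz →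
      ¬ (3 : ℤ) ∣ Dz →
      W.j = (⟨(a1 : ℚ), (a2 : ℚ), (a3 : ℚ), (a4 : ℚ), (a6 : ℚ)⟩ : WeierstrassCurve ℚ).j →
      W.j ≠ 0 → W.j ≠ 1728 → _ :=
    fun a1 a2 a3 a4 a6 _ Dz hΔ hDℓ hjE h0 h1728 ↦
      hasGoodReductionAt_or_kodairaSymbolAt_eq_Istar_zero_of_j_eq_twist W v hv2 a1 a2 a3 a4 a6 hΔ
        (by rw [hv]; exact_mod_cast hDℓ) hjE h0 h1728
  have fin : ∀ {P : Prop}, W.j ≠ 0 → W.j ≠ 1728 →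
      (W.HasGoodReductionAt v ∨ W.kodairaSymbolAt v = .Istar 0) →
      (W.HasGoodReductionAt v ∨ P ∨ (W.j ≠ 0 ∧ W.j ≠ 1728 ∧ W.kodairaSymbolAt v = .Istar 0)) := by
    intro P h0 h1728 h
    rcases h with h | h
    · exact Or.inl h
    · exact Or.inr (Or.inr ⟨h0, h1728, h⟩)
  simp only [cmJInvariants, Finset.mem_insert, Finset.mem_singleton] at hj
  rcases hj with h | h | h | h | h | h | h | h | h | h | h | h | h
  · -- `j = 0`: CM field `ℚ(√−3)`, ramified at `3`
    exact (hram h (by norm_num [cmFieldDiscrOfJ])).elim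
  · -- `j = 1728`
    rcases hasGoodReductionAt_or_kodairaSymbolAt_of_j_eq_1728 W h v hv2 with hg | hk
    · exact Or.inl hg
    · exact Or.inr (Or.inl ⟨h, hk⟩)
  · -- `j = -3375`: base `49a1 = [1, -1, 0, -2, -1]`, `Δ = -343 = -7³`
    haveI := isElliptic_of_discOf_ne_zero 1 (-1) 0 (-2) (-1) (by decide)
    have hjE : (⟨((1 : ℤ) : ℚ), ((-1 : ℤ) : ℚ), ((0 : ℤ) : ℚ), ((-2 : ℤ) : ℚ), ((-1 : ℤ) : ℚ)⟩ : WeierstrassCurve ℚ).j = -3375 := by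
      rw [j, Units.inv_mul_eq_iff_eq_mul, coe_Δ']
      norm_num [WeierstrassCurve.c₄, WeierstrassCurve.Δ, WeierstrassCurve.b₂, WeierstrassCurve.b₄, WeierstrassCurve.b₆, WeierstrassCurve.b₈]
    exact fin (by rw [h]; norm_num) (by rw [h]; norm_num) (twist 1 (-1) 0 (-2) (-1) (-343)
      (by norm_num [WeierstrassCurve.Δ, WeierstrassCurve.b₂, WeierstrassCurve.b₄, WeierstrassCurve.b₆, WeierstrassCurve.b₈])
      (by norm_num) (h.trans hjE.symm) (by rw [h]; norm_num) (by rw [h]; norm_num))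
  · -- `j = 8000`: base `256a1 = [0, 1, 0, -3, 1]`, `Δ = 512 = 2⁹`
    haveI := isElliptic_of_discOf_ne_zero 0 1 0 (-3) 1 (by decide)
    have hjE : (⟨((0 : ℤ) : ℚ), ((1 : ℤ) : ℚ), ((0 : ℤ) : ℚ), ((-3 : ℤ) : ℚ), ((1 : ℤ) : ℚ)⟩ : WeierstrassCurve ℚ).j = 8000 := by
      rw [j, Units.inv_mul_eq_iff_eq_mul, coe_Δ']
      norm_num [WeierstrassCurve.c₄, WeierstrassCurve.Δ, WeierstrassCurve.b₂, WeierstrassCurve.b₄, WeierstrassCurve.b₆, WeierstrassCurve.b₈]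
    exact fin (by rw [h]; norm_num) (by rw [h]; norm_num) (twist 0 1 0 (-3) 1 512
      (by norm_num [WeierstrassCurve.Δ, WeierstrassCurve.b₂, WeierstrassCurve.b₄, WeierstrassCurve.b₆, WeierstrassCurve.b₈])
      (by norm_num) (h.trans hjE.symm) (by rw [h]; norm_num) (by rw [h]; norm_num))
  · -- `j = -32768`: base `121b1 = [0, -1, 1, -7, 10]`, `Δ = -1331 = -11³`
    haveI := isElliptic_of_discOf_ne_zero 0 (-1) 1 (-7) 10 (by decide)
    have hjE : (⟨((0 : ℤ) : ℚ), ((-1 : ℤ) : ℚ), ((1 : ℤ) : ℚ), ((-7 : ℤ) : ℚ), ((10 : ℤ) : ℚ)⟩ : WeierstrassCurve ℚ).j = -32768 := by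
      rw [j, Units.inv_mul_eq_iff_eq_mul, coe_Δ']
      norm_num [WeierstrassCurve.c₄, WeierstrassCurve.Δ, WeierstrassCurve.b₂, WeierstrassCurve.b₄, WeierstrassCurve.b₆, WeierstrassCurve.b₈]
    exact fin (by rw [h]; norm_num) (by rw [h]; norm_num) (twist 0 (-1) 1 (-7) 10 (-1331)
      (by norm_num [WeierstrassCurve.Δ, WeierstrassCurve.b₂, WeierstrassCurve.b₄, WeierstrassCurve.b₆, WeierstrassCurve.b₈])
      (by norm_num) (h.trans hjE.symm) (by rw [h]; norm_num) (by rw [h]; norm_num))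
  · -- `j = 54000`: CM field `ℚ(√−3)` (order of conductor 2), ramified at `3`
    exact (hram h (by norm_num [cmFieldDiscrOfJ])).elim
  · -- `j = 287496`: base `32a3 = [0, 0, 0, -11, -14]`, `Δ = 512 = 2⁹`
    haveI := isElliptic_of_discOf_ne_zero 0 0 0 (-11) (-14) (by decide)
    have hjE : (⟨((0 : ℤ) : ℚ), ((0 : ℤ) : ℚ), ((0 : ℤ) : ℚ), ((-11 : ℤ) : ℚ), ((-14 : ℤ) : ℚ)⟩ : WeierstrassCurve ℚ).j = 287496 := by
      rw [j, Units.inv_mul_eq_iff_eq_mul, coe_Δ']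
      norm_num [WeierstrassCurve.c₄, WeierstrassCurve.Δ, WeierstrassCurve.b₂, WeierstrassCurve.b₄, WeierstrassCurve.b₆, WeierstrassCurve.b₈]
    exact fin (by rw [h]; norm_num) (by rw [h]; norm_num) (twist 0 0 0 (-11) (-14) 512
      (by norm_num [WeierstrassCurve.Δ, WeierstrassCurve.b₂, WeierstrassCurve.b₄, WeierstrassCurve.b₆, WeierstrassCurve.b₈])
      (by norm_num) (h.trans hjE.symm) (by rw [h]; norm_num) (by rw [h]; norm_num))
  · -- `j = -884736`: base `361a1 = [0, 0, 1, -38, 90]`, `Δ = -6859 = -19³`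
    haveI := isElliptic_of_discOf_ne_zero 0 0 1 (-38) 90 (by decide)
    have hjE : (⟨((0 : ℤ) : ℚ), ((0 : ℤ) : ℚ), ((1 : ℤ) : ℚ), ((-38 : ℤ) : ℚ), ((90 : ℤ) : ℚ)⟩ : WeierstrassCurve ℚ).j = -884736 := by
      rw [j, Units.inv_mul_eq_iff_eq_mul, coe_Δ']
      norm_num [WeierstrassCurve.c₄, WeierstrassCurve.Δ, WeierstrassCurve.b₂, WeierstrassCurve.b₄, WeierstrassCurve.b₆, WeierstrassCurve.b₈]
    exact fin (by rw [h]; norm_num) (by rw [h]; norm_num) (twist 0 0 1 (-38) 90 (-6859)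
      (by norm_num [WeierstrassCurve.Δ, WeierstrassCurve.b₂, WeierstrassCurve.b₄, WeierstrassCurve.b₆, WeierstrassCurve.b₈])
      (by norm_num) (h.trans hjE.symm) (by rw [h]; norm_num) (by rw [h]; norm_num))
  · -- `j = -12288000`: CM field `ℚ(√−3)` (order of conductor 3), ramified at `3`
    exact (hram h (by norm_num [cmFieldDiscrOfJ])).elim
  · -- `j = 16581375`: base `49a2 = [1, -1, 0, -37, -78]`, `Δ = 343 = 7³`
    haveI := isElliptic_of_discOf_ne_zero 1 (-1) 0 (-37) (-78) (by decide)
    have hjE : (⟨((1 : ℤ) : ℚ), ((-1 : ℤ) : ℚ), ((0 : ℤ) : ℚ), ((-37 : ℤ) : ℚ), ((-78 : ℤ) : ℚ)⟩ : WeierstrassCurve ℚ).j = 16581375 := by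
      rw [j, Units.inv_mul_eq_iff_eq_mul, coe_Δ']
      norm_num [WeierstrassCurve.c₄, WeierstrassCurve.Δ, WeierstrassCurve.b₂, WeierstrassCurve.b₄, WeierstrassCurve.b₆, WeierstrassCurve.b₈]
    exact fin (by rw [h]; norm_num) (by rw [h]; norm_num) (twist 1 (-1) 0 (-37) (-78) 343
      (by norm_num [WeierstrassCurve.Δ, WeierstrassCurve.b₂, WeierstrassCurve.b₄, WeierstrassCurve.b₆, WeierstrassCurve.b₈])
      (by norm_num) (h.trans hjE.symm) (by rw [h]; norm_num) (by rw [h]; norm_num))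
  · -- `j = -884736000`: base `1849a1 = [0, 0, 1, -860, 9707]`, `Δ = -79507 = -43³`
    haveI := isElliptic_of_discOf_ne_zero 0 0 1 (-860) 9707 (by decide)
    have hjE : (⟨((0 : ℤ) : ℚ), ((0 : ℤ) : ℚ), ((1 : ℤ) : ℚ), ((-860 : ℤ) : ℚ), ((9707 : ℤ) : ℚ)⟩ : WeierstrassCurve ℚ).j = -884736000 := by
      rw [j, Units.inv_mul_eq_iff_eq_mul, coe_Δ']
      norm_num [WeierstrassCurve.c₄, WeierstrassCurve.Δ, WeierstrassCurve.b₂, WeierstrassCurve.b₄, WeierstrassCurve.b₆, WeierstrassCurve.b₈]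
    exact fin (by rw [h]; norm_num) (by rw [h]; norm_num) (twist 0 0 1 (-860) 9707 (-79507)
      (by norm_num [WeierstrassCurve.Δ, WeierstrassCurve.b₂, WeierstrassCurve.b₄, WeierstrassCurve.b₆, WeierstrassCurve.b₈])
      (by norm_num) (h.trans hjE.symm) (by rw [h]; norm_num) (by rw [h]; norm_num))
  · -- `j = -147197952000`: base `4489a1 = [0, 0, 1, -7370, 243528]`, `Δ = -300763 = -67³`
    haveI := isElliptic_of_discOf_ne_zero 0 0 1 (-7370) 243528 (by decide)
    have hjE : (⟨((0 : ℤ) : ℚ), ((0 : ℤ) : ℚ), ((1 : ℤ) : ℚ), ((-7370 : ℤ) : ℚ), ((243528 : ℤ) : ℚ)⟩ : WeierstrassCurve ℚ).j = -147197952000 := by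
      rw [j, Units.inv_mul_eq_iff_eq_mul, coe_Δ']
      norm_num [WeierstrassCurve.c₄, WeierstrassCurve.Δ, WeierstrassCurve.b₂, WeierstrassCurve.b₄, WeierstrassCurve.b₆, WeierstrassCurve.b₈]
    exact fin (by rw [h]; norm_num) (by rw [h]; norm_num) (twist 0 0 1 (-7370) 243528 (-300763)
      (by norm_num [WeierstrassCurve.Δ, WeierstrassCurve.b₂, WeierstrassCurve.b₄, WeierstrassCurve.b₆, WeierstrassCurve.b₈])
      (by norm_num) (h.trans hjE.symm) (by rw [h]; norm_num) (by rw [h]; norm_num))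
  · -- `j = -262537412640768000`: base `26569a1 = [0, 0, 1, -2174420, 1234136692]`, `Δ = -4330747 = -163³`
    haveI := isElliptic_of_discOf_ne_zero 0 0 1 (-2174420) 1234136692 (by decide)
    have hjE : (⟨((0 : ℤ) : ℚ), ((0 : ℤ) : ℚ), ((1 : ℤ) : ℚ), ((-2174420 : ℤ) : ℚ), ((1234136692 : ℤ) : ℚ)⟩ : WeierstrassCurve ℚ).j = -262537412640768000 := by
      rw [j, Units.inv_mul_eq_iff_eq_mul, coe_Δ']
      norm_num [WeierstrassCurve.c₄, WeierstrassCurve.Δ, WeierstrassCurve.b₂, WeierstrassCurve.b₄, WeierstrassCurve.b₆, WeierstrassCurve.b₈]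
    exact fin (by rw [h]; norm_num) (by rw [h]; norm_num) (twist 0 0 1 (-2174420) 1234136692 (-4330747)
      (by norm_num [WeierstrassCurve.Δ, WeierstrassCurve.b₂, WeierstrassCurve.b₄, WeierstrassCurve.b₆, WeierstrassCurve.b₈])
      (by norm_num) (h.trans hjE.symm) (by rw [h]; norm_num) (by rw [h]; norm_num))

/-- **K12i@3 local types.** For `W/ℚ` in class X12 at `p = 3` with `3` INERT in the CM field
(`CMInert W 3`, i.e. `K ∈ {ℚ(i), ℚ(√−7), ℚ(√−19), ℚ(√−43), ℚ(√−67), ℚ(√−163)}`) and BAD reduction at `3`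
(RESIDUAL-MAP row K12i@3 = O10 at `p = 3`), at the place `v` over `3`: either `j = 1728` and the
Kodaira type is `III, I₀*` or `III*`, or `j ∉ {0, 1728}` and the type is `I₀*`. [cite: SilvermanATAEC1994, IV.9.4, Table 4.1 and App. A §3]
[cite: SilvermanAEC2009, X.5 Prop. 5.4] -/
theorem localType_of_classX12_three_of_cmInert (W : WeierstrassCurve ℚ) [W.IsElliptic]
    [Fact (3 : ℕ).Prime] (hX : ClassX12 W 3) (hin : CMInert W 3) (hbad : ¬ Good W 3)
    (v : HeightOneSpectrum (𝓞 ℚ)) (hv : natGenerator v = 3) :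
    (W.j = 1728 ∧ (W.kodairaSymbolAt v = .III ∨ W.kodairaSymbolAt v = .Istar 0 ∨
        W.kodairaSymbolAt v = .IIIstar)) ∨
      (W.j ≠ 0 ∧ W.j ≠ 1728 ∧ W.kodairaSymbolAt v = .Istar 0) := by
  have hbad' : ¬ W.HasGoodReductionAt v := by rwa [← good_iff_hasGoodReductionAt W 3 v hv]
  rcases hasGoodReductionAt_or_kodairaSymbolAt_of_hasCM_three W hX.1 v hv hin.1 with h | h
  · exact absurd h hbad'
  · exact h

/-- **`e ∣ 3 + 1` on K12i@3**: for an X12 pair at `p = 3` with `3` inert in the CM field and bad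
reduction at `3`, the Kodaira type at the place over `3` is `III`, `I₀*` or `III*` — semistability
defect `e ∈ {4, 2, 4}`, each dividing `3 + 1 = 4`; in particular the types `II, IV, IV*, II*`
(`e ∈ {3, 6}`, the `ℚ(√−3)` types) do NOT occur. This is the `p = 3` line of the local-type law
`semistabilityDefect_dvd_succ_of_classX12_of_cmInert` (`p ≥ 5`): the local problems `(Rubin_η)` at
`p = 3` are indexed by `e ∈ {2, 4}` (Yan–Zhu 2024 is the untwisted `p = 3` case).
[cite: SilvermanATAEC1994, IV.9.4, Table 4.1 and App. A §3] [cite: YanZhu2025, Thm. 1.1] -/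
theorem kodairaSymbolAt_three_of_classX12_of_cmInert (W : WeierstrassCurve ℚ) [W.IsElliptic]
    [Fact (3 : ℕ).Prime] (hX : ClassX12 W 3) (hin : CMInert W 3) (hbad : ¬ Good W 3)
    (v : HeightOneSpectrum (𝓞 ℚ)) (hv : natGenerator v = 3) :
    (W.kodairaSymbolAt v = .III ∨ W.kodairaSymbolAt v = .Istar 0 ∨ W.kodairaSymbolAt v = .IIIstar) ∧
      W.kodairaSymbolAt v ≠ .II ∧ W.kodairaSymbolAt v ≠ .IV ∧ W.kodairaSymbolAt v ≠ .IVstar ∧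
      W.kodairaSymbolAt v ≠ .IIstar := by
  rcases localType_of_classX12_three_of_cmInert W hX hin hbad v hv with ⟨-, hk⟩ | ⟨-, -, hk⟩
  · refine ⟨hk, ?_, ?_, ?_, ?_⟩ <;> rcases hk with hk | hk | hk <;> rw [hk] <;> decide
  · refine ⟨Or.inr (Or.inl hk), ?_, ?_, ?_, ?_⟩ <;> rw [hk] <;> decide

end Summit.BirchSwinnertonDyer.Rank1Residual.X12

end
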